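import Literature.Analysis.FluidPDE.LocalTypeI
import Literature.Analysis.FluidPDE.SereginSverakAxisymmetric
import HarnessLib

/-!
# Quantitative shells of regularity for local suitable weak solutions (Lei–Ren 2024; Lei–Ren–Tian 2025, Lemma 2.4)

Topic `Analysis/FluidPDE` (family `ns`). Statement-only reproduction (two named facts, no proof) of the
**quantitative shells of regularity** of Z. Lei, X. Ren, *Quantitative partial regularity of the
Navier–Stokes equations and applications*, Adv. Math. 445 (2024) 109654 = arXiv:2210.01783
[LeiRen2024QuantitativePartialRegularity] — Theorem 2 (quantitative interval of regularity), Remark 8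
(quantitative annulus of regularity) and Proposition 9 (quantitative epoch of regularity), arXiv p. 5 — in
the combined form in which they are printed and used by Z. Lei, X. Ren, G. Tian, *A geometric
characterization of potential Navier–Stokes singularities*, arXiv:2501.08976 [LeiRenTian2025], **Lemma 2.4**
(§2.2, arXiv p. 7) and §4 (display (4.8), arXiv p. 11). Requested by route `AxisTwistDoor` of
`NavierStokesRegularity` (crux `AveragedConeLiouville`, line `lrt_shell`, stub `fact_regularShell : ShellFact`,
which SPECIALISES the flat-cylinder fact below to the route's energy class; cite item wi-87109). The companion
input of that line, Lei–Ren–Tian's Lemma 2.5 (Nazarov–Ural'tseva propagation of positivity), is the accepted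
`Literature.Analysis.FluidPDE.NazarovUraltseva2011_positivity_propagation` (`DivFreeDriftPositivityPropagation.lean`).

## The results, as printed

Lei–Ren–Tian, arXiv:2501.08976, §2 (p. 6): `B(r) = {x ∈ ℝ³ : |x| < r}`, `Q(r) = B(r) × (−r², 0)`,
`𝓑(r) = {x ∈ ℝ³ : |x_h| < r, |x₃| < r}`, `𝓠(r) = 𝓑(r) × (−r², 0)`; Remark 2.1: "In this section, we state all
the definitions and lemmas using `B(r)` and `Q(r)`, but one can directly replace them with `𝓑(r)` and `𝓠(r)`
when the latter choice is more convenient." §2.1 (p. 6): a local suitable weak solution `(v, p)` in `Q(1)` has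
the finite local energies (2.3) `sup_{−1<t<0} ∫_{B(1)} |v|² + ∫_{Q(1)} |∇v|² + ∫_{Q(1)} |p|^{3/2} < +∞`, solves
the Navier–Stokes equations (`ν = 1`, no force) in the sense of distributions and satisfies the local energy
inequality (2.4) for nonnegative smooth `φ` compactly supported in `Q(1)`; "We shall often write
`G = G[v,p] := ∫_{Q(1)} (|v|³ + |p|^{3/2}) dx dt + 2`, which is finite due to (2.3) and interpolation."

**Lemma 2.4** (p. 7, "[LR] Qantitative shells of regularity"). "Let `v` be a suitable weak solution in `Q(1)`
and denote `G = ∫_{Q(1)} (|v|³ + |p|^{3/2}) dx dt + 2 < +∞`. There exist numbers `a ∈ (2/3, 3/4)` and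
`δ ∈ (G^{−O(G)}, 1/10)` such that `v` is regular in the space-time closure of `Q(a + δ) ∖ Q(a − δ)` with the
estimates (2.10) `sup_{Q(a+δ) ∖ Q(a−δ)} (|v| + |∇v| + |∇²v|) < G^{O(G)}`. Here, `O(G)` stands for a positive
number bounded by `G` times a universal constant." Followed by: "To be precise, quantitative intervals of
regularity in the spatial direction is stated in [LR, Thm 2 / Remark 8], and the corresponding (but much easier)
result in the temporal direction is stated in [LR, Prop 9]. Combining these results, it is easy to deduce
Lemma 2.4. Moreover, by simple modifications in the proof (see [LR]), one can replace `B(r), Q(r)` with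
`𝓑(r), 𝓠(r)` in the statement of Lemma 2.4." In §4 (p. 11, (4.8)) the flat-cylinder version is applied to a
suitable weak solution in `𝓠(1)`.

Lei–Ren, arXiv:2210.01783, p. 3: Definition 1 ("a point `w = (x,t)` is a regular point of `v`, if `v` is bounded
(and Hölder continuous) in `Q(r,w)` for some `r > 0`. Here `Q(r,w) = Q(r) + w` and `Q(r) = B(r) × (−r², 0)` …
For a solution `v` in the spacetime cylinder `Q(1)`, it is understood that `𝒮[v] ⊂ Q(1) ∪ (B(1) × {0})`" —
BACKWARD cylinders with vertex at the point); Definition 2 (local suitable weak solution in `𝒟`: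
`v ∈ L^∞_t L²_x(𝒟)`, `∇v ∈ L²(𝒟)`, `p ∈ L^{3/2}(𝒟)`, the equations in `𝒟'`, the local energy inequality for
`0 ≤ φ ∈ C_0^∞(𝒟)`; "this is the definition from [Lin]"); p. 4: `𝒢[v,p] = ∫_{Q(1)} (|v|³ + |p|^{3/2})`,
`𝓗[v] = ∫_{Q(1)} |∇v|²`; p. 5: **Theorem 2** (for `0 < ρ < 1`, `−1 < a < b < 1` an interval
`(z₁, z₂) ⊂ (a, b)`, `|z₂ − z₁| ≥ h₁(𝒢, 𝓗) = (𝒢+2)^{−M₁(min{𝓗,𝒢}+1)}`, `M₁ = M₁(ρ,a,b) > 0`, with `v` regular in the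
closure of `𝓘 = {(x,t) ∈ Q(ρ) : z₁ < x₃ < z₂}` and (1.14) `‖∇ₓ^m v‖_{L^∞(\bar 𝓘)} ≲_m h₁^{−(m+1)}`, all `m`),
**Remark 8** (the same with annuli `r₁ < |x| < r₂`, `−ρ² < t < 0`, `(r₁, r₂) ⊂ (a, b) ⊂ (0, 1)`,
`|r₂ − r₁| ≥ (𝒢+2)^{−\tilde M₁(min{𝓗,𝒢}+1)}`), **Proposition 9** (epochs: for `0 < r < 1`, `−1 < a, b < 0` an
interval `(t₁, t₂) ⊂ (a, b)`, `|t₂ − t₁| ≥ h₂(𝒢) = M₂(𝒢+1)^{−M₃}`, `v` regular in the closure of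
`𝓙 = {(x,t) ∈ Q(r) : t₁ < t < t₂}`, `‖∇ₓ^m v‖_{L^∞(\bar 𝓙)} ≲_m h₂^{−(m+1)}`).

## Transcription into the tree's vocabulary (the conventions of `VorticityDoubleConeRegularity.lean`)

* Space–time is `ℝ × ℝ³`, **time first**, `ℝ³ = EuclideanSpace ℝ (Fin 3)`; `Q(r)` is
  `parabolicCylinder r (0 : ℝ × ℝ³) = (−r², 0) × B_r(0)` (`SuitableWeak.lean`); the flat cylinders are the
  accepted `SereginSverak2009.spaceCyl 0 r = {cylRadius x < r ∧ |x 2| < r} = 𝓑(r)` and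
  `SereginSverak2009.parCyl 0 r = (−r², 0) × 𝓑(r) = 𝓠(r)` (`SereginSverakAxisymmetric.lean`; Seregin–Šverák's
  `𝒞(x₀,R)`, `Q(z₀,R)` are literally Lei–Ren–Tian's `𝓑`, `𝓠`).
* *Local suitable weak solution in `Q(1)`* (LRT (2.3)–(2.4) = Lei–Ren Def. 2 = Lin 1998) is the accepted
  `IsSuitableWeakSolutionInBall 1 0 u p` (`LocalTypeI.lean`), exactly as for LRT Thm 1.1
  (`LeiRenTian2025_doubleCone_regularity`); in `𝓠(1)` it is the same four clauses over `parCyl 0 1`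
  (`LeiRen2024.IsSuitableWeakSolutionInCyl`, this file).
* `G`. The printed `G = ∫_{Q(1)} (|v|³ + |p|^{3/2}) + 2` enters only through the monotone expressions
  `G^{−O(G)}` (a lower bound for `δ`) and `G^{O(G)}` (an upper bound), and `O(G) ≤ M·G` for a universal `M`;
  since `x ↦ x^{Mx}` increases and `x ↦ x^{−Mx}` decreases on `x ≥ 2`, the statement for the exact `G` is
  EQUIVALENT to the statement for every real `G` with `∫_{Q(1)} (|v|³ + |p|^{3/2}) + 2 ≤ G`, which is the form
  recorded (one universal `M > 0` serving both `O(G)`'s; `G ^ (M * G)` is the real power `Real.rpow`).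
* *Regular in the space–time closure of the shell* is the backward notion of Lei–Ren Def. 1 / LRT footnote 1,
  `¬ IsBackwardSingularPoint u z` for every `z` in the closure (`u` essentially bounded on some
  `Q(z, r) = (t − r², t) × B_r(x)`; `not_isBackwardSingularPoint_iff`) — the only notion that makes sense at
  the points of the top lid `t = 0` of the closure for a solution living on `Q(1)`; it is NOT the centred
  `IsRegularPoint` of `SuitableWeak.lean`.
* *The shell.* The printed shell `Q(a+δ) ∖ Q(a−δ)` is recorded as the OPEN shell
  `S = Q(a+δ) ∖ \overline{Q(a−δ)}` (`parabolicCylinder (a+δ) 0 \ closure (parabolicCylinder (a−δ) 0)`), i.e.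
  the printed set minus the Lebesgue-null inner face `{|x| = a−δ, t > −(a−δ)²}` and lid
  `{t = −(a−δ)², |x| ≤ a−δ}` of the removed cylinder; it has the same closure, and every estimate on the
  printed set restricts to it, so nothing is claimed beyond print. On the open shell every point
  `z = (t, x) ∈ S` lies inside the backward cylinder of the slightly later shell point `(t + η, x)`, on which
  the solution is essentially bounded (that point being regular), so `S` is covered by open sets of
  essential boundedness, on which a local suitable weak solution has a representative that is Hölder
  continuous in space–time and smooth in the space variables (Serrin 1962; Caffarelli–Kohn–Nirenberg 1982,
  §6) — the representative whose derivatives (2.10) bounds. (At the lid of the removed cylinder only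
  one-sided-in-time information is printed, which is why the lid is left out of `S`.)
* *The estimate (2.10)* is therefore recorded, for the arbitrary representative `u` of Lean, as: there is
  `w : ℝ → ℝ³ → ℝ³`, jointly continuous on `S`, with every time slice `w(t, ·)` of class `C²` on the (open)
  slice `{x : (t,x) ∈ S}`, `u = w` almost everywhere on `S`, and
  `‖w(t,x)‖ + ‖Dw(t,·)(x)‖ + ‖D²w(t,·)(x)‖ ≤ G^{MG}` at every `(t,x) ∈ S` (`fderiv`, `iteratedFDeriv ℝ 2`,
  OPERATOR norms, which are at most the Euclidean norms `|∇v|`, `|∇²v|` of print; `≤` in place of the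
  printed strict `sup < G^{O(G)}`); and *regular in the space–time closure* as
  `¬ IsBackwardSingularPoint u z` for all `z ∈ closure S` (`LeiRen2024.IsRegularShellWith`). All of this is
  implied by the printed conclusion, so the recorded facts are at most WEAKER than print.
* Both geometries are recorded: `LeiRen2024_quantitative_regular_shells` (round, Lemma 2.4 verbatim) and
  `LeiRen2024_quantitative_regular_shells_cyl` (flat cylinders, Remark 2.1 / p. 7 last sentence / §4 (4.8) —
  the form consumed by `AxisTwistDoor`).
* Use. The recorded shells are open (`(isOpen_parabolicCylinder _ _).sdiff isClosed_closure`,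
  `(SereginSverak2009.isOpen_parCyl _ _).sdiff isClosed_closure`); for a velocity field that is itself
  jointly continuous on the shell (e.g. a mild bounded ancient profile) Mathlib's
  `MeasureTheory.Measure.eqOn_open_of_ae_eq` identifies it with the representative `w` on the shell, so the
  bound `‖u‖ ≤ G^{MG}` holds pointwise there; the monotonicity `G ≤ G' ⇒ G'^{−MG'} ≤ G^{−MG} ∧ G^{MG} ≤ G'^{MG'}`
  (`2 ≤ G`, `0 ≤ M`) is `Real.rpow_le_rpow` with `Real.rpow_le_rpow_of_exponent_le`.

## Deliberately not here

The proofs (energy pigeon-holing of the hollowed dissipation energies, [LR] §§2–4); the separate statements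
of [LR] Thm 2 / Remark 8 / Prop 9 with their two-parameter windows `(a,b)`, `ρ` and the `min{𝓗, 𝒢}`
exponent (only their combination, as printed by Lei–Ren–Tian, is recorded — TODO(general form)); the
higher estimates `m ≥ 3` of (1.14); [LR] Thm 1 (`𝒫^{r|ln r|}(𝒮) = 0`) and the axisymmetric applications
[LR] Thms 3–4; LRT Lemma 2.3 and §§3–4.

## Mathlib / tree search

`rg 'LeiRen2024|shells? of regularity|annulus of regularity|epoch of regularity'` over `Literature/`
(2026-08-28): no declaration (only prose mentions in `VorticityDoubleConeRegularity.lean` and the RRS epochs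
of regularity in `Barriers/NavierStokesRegularity/SingularSetDimensionBound.lean`, a different theorem).
Reused: `parabolicCylinder`, `IsSuitableWeakSolutionInBall`, `IsSuitableWeakSolutionOn`,
`HasWeakSpatialGradientOn`, `frobeniusNormSq`, `IsBackwardSingularPoint`, `SereginSverak2009.spaceCyl`,
`SereginSverak2009.parCyl`, `SereginSverak2009.parCylOpens`.

## References

* Z. Lei, X. Ren, *Quantitative partial regularity of the Navier–Stokes equations and applications*,
  Adv. Math. 445 (2024) 109654, doi:10.1016/j.aim.2024.109654 = arXiv:2210.01783: Def. 1–2 (p. 3), `𝒢`, `𝓗`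
  (p. 4), Thm 2, Remark 8, Prop 9 (p. 5). [LeiRen2024QuantitativePartialRegularity]
* Z. Lei, X. Ren, G. Tian, *A geometric characterization of potential Navier–Stokes singularities*,
  arXiv:2501.08976 [math.AP] (2025): §2 notation and Remark 2.1, §2.1 (2.3)–(2.4) (p. 6); Lemma 2.4 and the
  paragraph after it (p. 7); §4 (4.8) (p. 11). [LeiRenTian2025]
* D. Albritton, T. Barker, J. Math. Fluid Mech. 21 (2019), Def. 2.1, §1 (backward singular points).
  [AlbrittonBarker2019]
* G. Seregin, V. Šverák, Comm. PDE 34 (2009) = arXiv:0804.1803, §3 (the flat cylinders `𝒞(x₀,R)`,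
  `Q(z₀,R)`). [SereginSverak2009]
-/

noncomputable section

open MeasureTheory Set Function Metric
open scoped ENNReal NNReal

namespace Literature.Analysis.FluidPDE

namespace LeiRen2024

/-! ### The two recorded renderings: shell regularity with bounds, and the suitable class in a flat cylinder -/

/-- **"`v` is regular in the space–time closure of the shell `S`, with
`sup_S (|v| + |∇v| + |∇²v|) ≤ B`"** (the conclusion of Lei–Ren–Tian 2025, Lemma 2.4 / Lei–Ren 2024, Thm 2,
Remark 8, Prop 9), for a velocity field `u : ℝ → ℝ³ → ℝ³` (time first) and a space–time set `S` (in the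
applications an OPEN shell, so that its time slices are open and `fderiv` below is the genuine derivative),
rendered for an arbitrary representative `u` (module docstring, *The shell* and *The estimate (2.10)*):
(i) every point of `closure S` is regular in the backward sense (`¬ IsBackwardSingularPoint u z`: `u` is
essentially bounded on some `(t − r², t) × B_r(x)`, Lei–Ren Def. 1); (ii) there is `w : ℝ → ℝ³ → ℝ³`, jointly
continuous on `S`, each slice `w t` of class `C²` on the slice `{x | (t,x) ∈ S}`, with `u = w` a.e. on `S` and
`‖w t x‖ + ‖fderiv ℝ (w t) x‖ + ‖iteratedFDeriv ℝ 2 (w t) x‖ ≤ B` for every `(t, x) ∈ S` (operator norms).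
[cite: LeiRenTian2025, Lemma 2.4 (2.10) (arXiv p.7)] -/
def IsRegularShellWith (u : ℝ → EuclideanSpace ℝ (Fin 3) → EuclideanSpace ℝ (Fin 3))
    (S : Set (ℝ × EuclideanSpace ℝ (Fin 3))) (B : ℝ) : Prop :=
  (∀ z ∈ closure S, ¬ IsBackwardSingularPoint u z) ∧
    ∃ w : ℝ → EuclideanSpace ℝ (Fin 3) → EuclideanSpace ℝ (Fin 3),
      ContinuousOn (uncurry w) S ∧
      (∀ t : ℝ, ContDiffOn ℝ 2 (w t) {x | (t, x) ∈ S}) ∧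
      uncurry u =ᵐ[volume.restrict S] uncurry w ∧
      ∀ z ∈ S, ‖w z.1 z.2‖ + ‖fderiv ℝ (w z.1) z.2‖ + ‖iteratedFDeriv ℝ 2 (w z.1) z.2‖ ≤ B

/-- **Local suitable weak solutions in the flat cylinder `𝓠(r) = (−r², 0) × 𝓑(r)`,
`𝓑(r) = {|x_h| < r, |x₃| < r}`** (Lei–Ren–Tian 2025, §2.1 (2.3)–(2.4) read with Remark 2.1; Lei–Ren 2024,
Def. 2 with `𝒟 = 𝓠(r)`; Lin 1998): the four clauses of the accepted `IsSuitableWeakSolutionInBall`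
(Albritton–Barker 2019, Def. 2.1) with the round cylinder replaced by the accepted flat one
`SereginSverak2009.parCyl 0 r` — the local notion `IsSuitableWeakSolutionOn` (unit viscosity, zero force,
distributional equations, local energy inequality against `C_c^∞(𝓠(r))`) on `parCylOpens 0 r`, together with
the GLOBAL class (2.3) on `𝓠(r)`: `esssup_{−r²<t<0} ∫_{𝓑(r)} |u(t)|² < ∞`, `∇u ∈ L²(𝓠(r))` through a weak
spatial gradient, `p ∈ L^{3/2}(𝓠(r))`. [cite: LeiRenTian2025, §2.1 (2.3)–(2.4) with Remark 2.1 (arXiv p.6)] -/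
def IsSuitableWeakSolutionInCyl (r : ℝ) (u : ℝ → EuclideanSpace ℝ (Fin 3) → EuclideanSpace ℝ (Fin 3))
    (p : ℝ → EuclideanSpace ℝ (Fin 3) → ℝ) : Prop :=
  IsSuitableWeakSolutionOn (SereginSverak2009.parCylOpens 0 r) 1 0 u p ∧
    (∃ C : ℝ≥0, ∀ᵐ t ∂(volume.restrict (Ioo (-r ^ 2) 0)),
      ∫⁻ x in SereginSverak2009.spaceCyl 0 r, ‖u t x‖ₑ ^ 2 ≤ C) ∧
    (∃ G : ℝ → EuclideanSpace ℝ (Fin 3) → EuclideanSpace ℝ (Fin 3) →L[ℝ] EuclideanSpace ℝ (Fin 3),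
      HasWeakSpatialGradientOn (SereginSverak2009.parCylOpens 0 r) u G ∧
      ∫⁻ z in SereginSverak2009.parCyl 0 r, ENNReal.ofReal (frobeniusNormSq (G z.1 z.2)) < ∞) ∧
    MemLp (uncurry p) (3 / 2) (volume.restrict (SereginSverak2009.parCyl 0 r))

end LeiRen2024

/-! ### The named facts -/

/-- **Quantitative shells of regularity, round cylinders (Lei–Ren–Tian 2025, Lemma 2.4 = Lei–Ren 2024,
Thm 2 + Remark 8 + Prop 9 combined).** Printed (arXiv:2501.08976, p. 7): "Let `v` be a suitable weak solution
in `Q(1)` and denote `G = ∫_{Q(1)} (|v|³ + |p|^{3/2}) dx dt + 2 < +∞`. There exist numbers `a ∈ (2/3, 3/4)`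
and `δ ∈ (G^{−O(G)}, 1/10)` such that `v` is regular in the space-time closure of `Q(a + δ) ∖ Q(a − δ)` with
the estimates `sup_{Q(a+δ)∖Q(a−δ)} (|v| + |∇v| + |∇²v|) < G^{O(G)}`. Here, `O(G)` stands for a positive
number bounded by `G` times a universal constant." **Recorded statement** (module docstring for every
rendering choice): there is a universal `M > 0` such that for every local suitable weak solution `(u, p)` of
the unforced Navier–Stokes equations (`ν = 1`) in `Q(1) = (−1, 0) × B_1(0)` (`IsSuitableWeakSolutionInBall 1 0
u p`) and every real `G` with `∫_{Q(1)} (|u|³ + |p|^{3/2}) + 2 ≤ G`, there are `a ∈ (2/3, 3/4)` and `δ` with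
`G^{−MG} < δ < 1/10` such that the open parabolic shell `S = Q(a+δ) ∖ \overline{Q(a−δ)}` is regular with bound
`G^{MG}`: every point of `closure S` (= the printed space–time closure of `Q(a+δ) ∖ Q(a−δ)`) is a regular
point (backward sense), and a jointly continuous, spatially `C²` representative `w` of `u` on `S` has
`‖w‖ + ‖∇w‖ + ‖∇²w‖ ≤ G^{MG}` on `S` (`LeiRen2024.IsRegularShellWith`). Users take it as a hypothesis
`(h : LeiRen2024_quantitative_regular_shells)`.
[cite: LeiRenTian2025, Lemma 2.4 (arXiv:2501.08976, §2.2, p. 7)]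
[cite: LeiRen2024QuantitativePartialRegularity, Thm 2, Remark 8, Prop 9 (arXiv:2210.01783, p. 5)] -/
def LeiRen2024_quantitative_regular_shells : Prop :=
  ∃ M : ℝ, 0 < M ∧
    ∀ (u : ℝ → EuclideanSpace ℝ (Fin 3) → EuclideanSpace ℝ (Fin 3)) (p : ℝ → EuclideanSpace ℝ (Fin 3) → ℝ)
      (G : ℝ),
      IsSuitableWeakSolutionInBall 1 0 u p →
      (∫⁻ z in parabolicCylinder 1 (0 : ℝ × EuclideanSpace ℝ (Fin 3)),
          (‖u z.1 z.2‖ₑ ^ (3 : ℕ) + ‖p z.1 z.2‖ₑ ^ (3 / 2 : ℝ))) + 2 ≤ ENNReal.ofReal G →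
      ∃ a δ : ℝ, 2 / 3 < a ∧ a < 3 / 4 ∧ G ^ (-(M * G)) < δ ∧ δ < 1 / 10 ∧
        LeiRen2024.IsRegularShellWith u
          (parabolicCylinder (a + δ) (0 : ℝ × EuclideanSpace ℝ (Fin 3)) \
            closure (parabolicCylinder (a - δ) (0 : ℝ × EuclideanSpace ℝ (Fin 3))))
          (G ^ (M * G))

/-- **Quantitative shells of regularity, flat cylinders (Lei–Ren–Tian 2025, Lemma 2.4 with Remark 2.1 and
the last sentence of §2.2, p. 7: "by simple modifications in the proof (see [LR]), one can replace `B(r), Q(r)`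
with `𝓑(r), 𝓠(r)` in the statement of Lemma 2.4"; applied in this form in §4, (4.8), p. 11; Lei–Ren 2024,
Thm 2 + Remark 8 + Prop 9).** With `𝓑(r) = {x : |x_h| < r, |x₃| < r}` and `𝓠(r) = 𝓑(r) × (−r², 0)`
(`SereginSverak2009.spaceCyl 0 r`, `SereginSverak2009.parCyl 0 r`): there is a universal `M > 0` such that
for every local suitable weak solution `(u, p)` of the unforced Navier–Stokes equations (`ν = 1`) in `𝓠(1)`
(`LeiRen2024.IsSuitableWeakSolutionInCyl 1 u p`) and every real `G` with `∫_{𝓠(1)} (|u|³ + |p|^{3/2}) + 2 ≤ G`,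
there are `a ∈ (2/3, 3/4)` and `δ` with `G^{−MG} < δ < 1/10` such that the open flat parabolic shell
`S = 𝓠(a+δ) ∖ \overline{𝓠(a−δ)}` is regular with bound `G^{MG}` in the sense of `LeiRen2024.IsRegularShellWith`
(every point of `closure S` regular in the backward sense; a jointly continuous, spatially `C²` representative
with `‖w‖ + ‖∇w‖ + ‖∇²w‖ ≤ G^{MG}` on `S`). This is the form consumed by route `AxisTwistDoor`
(`fact_regularShell`). Users take it as a hypothesis `(h : LeiRen2024_quantitative_regular_shells_cyl)`.
[cite: LeiRenTian2025, Lemma 2.4 with Remark 2.1 and §4 (4.8) (arXiv:2501.08976, pp. 6–7, 11)]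
[cite: LeiRen2024QuantitativePartialRegularity, Thm 2, Remark 8, Prop 9 (arXiv:2210.01783, p. 5)] -/
def LeiRen2024_quantitative_regular_shells_cyl : Prop :=
  ∃ M : ℝ, 0 < M ∧
    ∀ (u : ℝ → EuclideanSpace ℝ (Fin 3) → EuclideanSpace ℝ (Fin 3)) (p : ℝ → EuclideanSpace ℝ (Fin 3) → ℝ)
      (G : ℝ),
      LeiRen2024.IsSuitableWeakSolutionInCyl 1 u p →
      (∫⁻ z in SereginSverak2009.parCyl 0 1,
          (‖u z.1 z.2‖ₑ ^ (3 : ℕ) + ‖p z.1 z.2‖ₑ ^ (3 / 2 : ℝ))) + 2 ≤ ENNReal.ofReal G →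
      ∃ a δ : ℝ, 2 / 3 < a ∧ a < 3 / 4 ∧ G ^ (-(M * G)) < δ ∧ δ < 1 / 10 ∧
        LeiRen2024.IsRegularShellWith u
          (SereginSverak2009.parCyl 0 (a + δ) \ closure (SereginSverak2009.parCyl 0 (a - δ)))
          (G ^ (M * G))

end Literature.Analysis.FluidPDE

end
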